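import Summits.HubbardSuperconductivity.HubbardSuperconductivity.Theorems.AnisotropyChordTransferFibre3DiagonalValues

/-!
# Route `AnisotropyChord` / H0 rotor rung: lemmas for the SHARP diagonal periodisation rate — Gudermannian bound, sharp inner ring sums, row errors, the Lambert row sum

Toolkit for `…Fibre3DiagonalRate` (`|a_L(n,n;0) − a_∞(n,n)| ≤ n²/L²`).  `…Fibre3DiagonalValues.aKer_diag_approx` bounded the
hyperbolic corrections of the diagonal row sums by Bernoulli (`(1+s)^L ≥ 1 + Ls`), losing a power of `L`; here they are summed sharply:
* ★ `exp_mul_cos_le_one_add_sin` — the Gudermannian inequality `eᵘ·cos u ≤ 1 + sin u` on `[0, π/2]` (monotonicity of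
  `1 + sin u − eᵘcos u`; derivative `eᵘ sin u − (eᵘ − 1)cos u ≥ 0` from `tan u ≥ u` and `eᵘ − 1 ≤ u eᵘ`), so the row parameter
  `t = (1 + sin w)/cos w ≥ e^{w}` and `t^L ≥ e^{Lw}`;
* `inner_sum_sharp` (`|S − L/(4 sin w)| ≤ (L/(4 sin w))·2/(e^{Lw} − 1)`), `row_err_core` (row error `≤ n²L sin w/(e^{Lw} − 1)` given
  `|sin u| = sin w`, `|cos u| = cos w`; sign flip by the half-period shift), `row_weight_le` (`≤ πn²m/(e^{πm} − 1)` at `w = πm/L`),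
  `row_reduced` (rows `p` and `L + p` have reduced distance `m = min(p, L − p)`);
* `twenty_le_exp_pi`, ★ `lambert_row_sum_le` (`Σ_{m<N} m/(e^{πm} − 1) ≤ 3/50`, `q = e^{−π} ≤ 1/20`, `Σ m qᵐ ≤ q/(1−q)²`);
* `cot_sum_approx` (`|(1/(2L))Σ_{k<n} cot θ_k − (1/π)Σ_{k<n} 1/(2k+1)| ≤ πn²/(8L²)`, `2n ≤ L`).
Prover seat `hubbard-h0-rotor-p1` g25; helper for stmt-HubbardSuperconductivity-19089 (`--supports`).
WHAT THIS IS NOT: nothing here proves superconductivity in the Hubbard model (rotor TARGET as worded stays FALSE, g15);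
elementary estimates serving ONE input (periodisation) of ONE input (HOLE₂) of ONE conditional reduction (rung 19089).
Mathlib + tree imports only; no sorry, no axioms.
-/


set_option linter.dupNamespace false
set_option autoImplicit false

noncomputable section

open scoped BigOperators
open Complex Filter Topology

namespace Summit.HubbardSuperconductivity.HubbardSuperconductivity.Theorems.AnisotropyChord.Transfer.Fibre3

variable (L : ℕ) [NeZero L]

/-! ## The Gudermannian inequality `eᵘ cos u ≤ 1 + sin u` on `[0, π/2]` -/

omit [NeZero L] in
/-- ★ `eᵘ·cos u ≤ 1 + sin u` for `0 ≤ u ≤ π/2` (i.e. `u ≤ gd⁻¹(u) = log(sec u + tan u)`). [folklore] -/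
theorem exp_mul_cos_le_one_add_sin {u : ℝ} (h0 : 0 ≤ u) (h1 : u ≤ Real.pi / 2) :
    Real.exp u * Real.cos u ≤ 1 + Real.sin u := by
  set G : ℝ → ℝ := fun x => 1 + Real.sin x - Real.exp x * Real.cos x with hG
  have hderiv : ∀ x, HasDerivAt G (Real.cos x - (Real.exp x * Real.cos x + Real.exp x * (-Real.sin x))) x := by
    intro x
    exact ((Real.hasDerivAt_sin x).const_add 1).sub ((Real.hasDerivAt_exp x).mul (Real.hasDerivAt_cos x))
  have hcont : ContinuousOn G (Set.Icc 0 (Real.pi / 2)) := fun x _ => (hderiv x).continuousAt.continuousWithinAt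
  have hdiff : DifferentiableOn ℝ G (interior (Set.Icc 0 (Real.pi / 2))) :=
    fun x _ => (hderiv x).differentiableAt.differentiableWithinAt
  have hpos : ∀ x ∈ interior (Set.Icc 0 (Real.pi / 2)), 0 ≤ deriv G x := by
    intro x hx
    rw [interior_Icc] at hx
    rw [(hderiv x).deriv]
    have hx0 : 0 < x := hx.1
    have hx1 : x < Real.pi / 2 := hx.2
    have hcos : 0 < Real.cos x := Real.cos_pos_of_mem_Ioo ⟨by linarith, hx1⟩
    have hexp : 0 < Real.exp x := Real.exp_pos x
    -- `sin x ≥ x cos x` (from `x ≤ tan x`) and `exp x − 1 ≤ x exp x` (from `1 − x ≤ exp(−x)`)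
    have htan := Real.le_tan hx0.le hx1
    rw [Real.tan_eq_sin_div_cos, le_div_iff₀ hcos] at htan
    have hem : Real.exp x - 1 ≤ x * Real.exp x := by
      have h := Real.add_one_le_exp (-x)
      have : Real.exp (-x) * Real.exp x = 1 := by rw [← Real.exp_add]; simp
      nlinarith
    nlinarith [mul_le_mul_of_nonneg_right hem hcos.le, mul_le_mul_of_nonneg_left htan hexp.le]
  have hmono := monotoneOn_of_deriv_nonneg (convex_Icc 0 (Real.pi / 2)) hcont hdiff hpos
  have hpi : 0 ≤ Real.pi / 2 := by positivity
  have h := hmono (Set.left_mem_Icc.mpr hpi) ⟨h0, h1⟩ h0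
  have hG0 : G 0 = 0 := by simp [hG]
  rw [hG0] at h
  simp only [hG] at h
  linarith

/-! ## The sharp inner ring sum bound -/

/-- ★ the inner ring sum at angle `w ∈ (0, π/2)`: `|Σ_{j<L} 1/(4 − 4cos w·cos(π(2j+τ)/L)) − L/(4 sin w)| ≤ (L/(4 sin w))·2/(e^{Lw} − 1)`. [folklore] -/
theorem inner_sum_sharp {w : ℝ} (hw0 : 0 < w) (hw1 : w < Real.pi / 2) (τ : ℕ) :
    |∑ j ∈ Finset.range L, 1 / (4 - 4 * Real.cos w * Real.cos (Real.pi * ((2 * j + τ : ℕ) : ℝ) / L)) - L / (4 * Real.sin w)|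
      ≤ L / (4 * Real.sin w) * (2 / (Real.exp (L * w) - 1)) := by
  have hL0 : (0 : ℝ) < L := by exact_mod_cast Nat.pos_of_ne_zero (NeZero.ne L)
  have hcos : 0 < Real.cos w := Real.cos_pos_of_mem_Ioo ⟨by linarith, hw1⟩
  have hcos1 : Real.cos w < 1 := by
    have := Real.cos_lt_cos_of_nonneg_of_le_pi_div_two le_rfl hw1.le hw0
    rwa [Real.cos_zero] at this
  have hsin : 0 < Real.sin w := Real.sin_pos_of_pos_of_lt_pi hw0 (by linarith [Real.pi_pos])
  have hsq : Real.sqrt (1 - Real.cos w ^ 2) = Real.sin w := by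
    rw [← Real.abs_sin_eq_sqrt_one_sub_cos_sq, abs_of_pos hsin]
  rw [inner_sum_closed L hcos hcos1 τ, hsq]
  set t : ℝ := (1 + Real.sin w) / Real.cos w with ht
  set X : ℝ := L * Real.log t with hX
  have ht1 : 1 < t := by rw [ht, lt_div_iff₀ hcos]; linarith
  have ht0 : 0 < t := by linarith
  have hX0 : 0 < X := by rw [hX]; exact mul_pos hL0 (Real.log_pos ht1)
  have hT := abs_sinh_div_cosh_sub_pow_sub_one hX0 τ
  -- `exp X = t^L ≥ (e^w)^L = e^{Lw}`
  have hexpX : Real.exp X = t ^ L := by rw [hX, Real.exp_nat_mul, Real.exp_log ht0]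
  have hgd : Real.exp w ≤ t := by
    rw [ht, le_div_iff₀ hcos]; exact exp_mul_cos_le_one_add_sin hw0.le hw1.le
  have hLw : Real.exp (L * w) ≤ Real.exp X := by
    rw [hexpX, Real.exp_nat_mul]
    exact pow_le_pow_left₀ (Real.exp_pos w).le hgd L
  have hLw1 : 1 < Real.exp (L * w) := Real.one_lt_exp_iff.mpr (by positivity)
  have hT' : |Real.sinh X / (Real.cosh X - (-1) ^ τ) - 1| ≤ 2 / (Real.exp (L * w) - 1) :=
    hT.trans (div_le_div_of_nonneg_left (by norm_num) (by linarith) (by linarith))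
  have e : (L : ℝ) / (4 * Real.sin w) * (Real.sinh X / (Real.cosh X - (-1) ^ τ)) - L / (4 * Real.sin w)
      = (L : ℝ) / (4 * Real.sin w) * (Real.sinh X / (Real.cosh X - (-1) ^ τ) - 1) := by ring
  rw [e, abs_mul, abs_of_pos (by positivity : (0 : ℝ) < L / (4 * Real.sin w))]
  exact mul_le_mul_of_nonneg_left hT' (by positivity)

/-! ## Row errors -/

/-- core row estimate: if `|sin u| = sin w`, `|cos u| = cos w` with `0 < w ≤ π/2`, then for every parity shift `τ`
`|(1 − cos 2nu)·(S(u,τ) − L/(4|sin u|))| ≤ n²·L·sin w/(e^{Lw} − 1)`. [folklore] -/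
theorem row_err_core (n τ : ℕ) {u w : ℝ} (hw0 : 0 < w) (hw1 : w ≤ Real.pi / 2)
    (hs : |Real.sin u| = Real.sin w) (hc : |Real.cos u| = Real.cos w) :
    |(1 - Real.cos (2 * n * u)) * (∑ j ∈ Finset.range L,
        1 / (4 - 0 - 4 * Real.cos u * Real.cos (Real.pi * ((2 * j + τ : ℕ) : ℝ) / L)) - L / (4 * |Real.sin u|))|
      ≤ (n : ℝ) ^ 2 * L * Real.sin w / (Real.exp (L * w) - 1) := by
  have hL0 : (0 : ℝ) < L := by exact_mod_cast Nat.pos_of_ne_zero (NeZero.ne L)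
  have hsinw : 0 < Real.sin w := Real.sin_pos_of_pos_of_lt_pi hw0 (by linarith [Real.pi_pos])
  have hE : 1 < Real.exp (L * w) := Real.one_lt_exp_iff.mpr (by positivity)
  have hRHS : 0 ≤ (n : ℝ) ^ 2 * L * Real.sin w / (Real.exp (L * w) - 1) := by
    apply div_nonneg (by positivity); linarith
  have hpre : 0 ≤ 1 - Real.cos (2 * n * u) := by linarith [Real.cos_le_one (2 * n * u)]
  have hle := one_sub_cos_two_mul_le n u
  have hs2 : Real.sin u ^ 2 = Real.sin w ^ 2 := by rw [← sq_abs, hs]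
  rw [hs2] at hle
  rw [hs]
  simp only [sub_zero]
  rcases hw1.lt_or_eq with hw1' | hw1'
  · have hcosw : 0 < Real.cos w := Real.cos_pos_of_mem_Ioo ⟨by linarith, hw1'⟩
    -- the inner sum is within `(L/(4 sin w))·2/(e^{Lw}−1)` of `L/(4 sin w)`, in both sign cases
    have hS : |∑ j ∈ Finset.range L, 1 / (4 - 4 * Real.cos u * Real.cos (Real.pi * ((2 * j + τ : ℕ) : ℝ) / L))
        - L / (4 * Real.sin w)| ≤ L / (4 * Real.sin w) * (2 / (Real.exp (L * w) - 1)) := by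
      rcases le_or_gt 0 (Real.cos u) with hcu | hcu
      · rw [abs_of_nonneg hcu] at hc
        rw [hc]
        exact inner_sum_sharp L hw0 hw1' τ
      · rw [abs_of_neg hcu] at hc
        have hc' : Real.cos u = -Real.cos w := by linarith
        have hterm : ∀ j : ℕ, 4 - 4 * Real.cos u * Real.cos (Real.pi * ((2 * j + τ : ℕ) : ℝ) / L)
            = 4 - 4 * Real.cos w * Real.cos (Real.pi * ((2 * j + (τ + L) : ℕ) : ℝ) / L) := by
          intro j
          have e : Real.pi * ((2 * j + (τ + L) : ℕ) : ℝ) / L = Real.pi * ((2 * j + τ : ℕ) : ℝ) / L + Real.pi := by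
            push_cast; field_simp; ring
          rw [e, Real.cos_add_pi, hc']; ring
        simp only [hterm]
        exact inner_sum_sharp L hw0 hw1' (τ + L)
    rw [abs_mul, abs_of_nonneg hpre]
    calc (1 - Real.cos (2 * n * u)) * |∑ j ∈ Finset.range L,
          1 / (4 - 4 * Real.cos u * Real.cos (Real.pi * ((2 * j + τ : ℕ) : ℝ) / L)) - L / (4 * Real.sin w)|
        ≤ (2 * n ^ 2 * Real.sin w ^ 2) * (L / (4 * Real.sin w) * (2 / (Real.exp (L * w) - 1))) :=
          mul_le_mul hle hS (abs_nonneg _) (by positivity)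
      _ = (n : ℝ) ^ 2 * L * Real.sin w / (Real.exp (L * w) - 1) := by
          field_simp
          ring
  · -- `w = π/2`: `cos u = 0`, the inner sum is `L/4` exactly
    have hcw : Real.cos w = 0 := by rw [hw1', Real.cos_pi_div_two]
    have hsw : Real.sin w = 1 := by rw [hw1', Real.sin_pi_div_two]
    have hcu : Real.cos u = 0 := by rw [hcw] at hc; exact abs_eq_zero.mp hc
    simp only [hcu, mul_zero, zero_mul, sub_zero, Finset.sum_const, Finset.card_range, nsmul_eq_mul, hsw, mul_one]
    rw [show (L : ℝ) * (1 / 4) - L / 4 = 0 by ring, mul_zero, abs_zero]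
    rw [hsw] at hRHS
    simpa using hRHS

/-- the Lambert-type weight of a row at reduced distance `m`: `B(m) = π n² m/(e^{πm} − 1)`; `sin(πm/L) ≤ πm/L` turns the core
estimate into `B`. [folklore] -/
theorem row_weight_le (n m : ℕ) :
    (n : ℝ) ^ 2 * L * Real.sin (Real.pi * m / L) / (Real.exp (L * (Real.pi * m / L)) - 1)
      ≤ Real.pi * (n : ℝ) ^ 2 * m / (Real.exp (Real.pi * m) - 1) := by
  have hL0 : (0 : ℝ) < L := by exact_mod_cast Nat.pos_of_ne_zero (NeZero.ne L)
  have e : (L : ℝ) * (Real.pi * m / L) = Real.pi * m := by field_simp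
  rw [e]
  rcases Nat.eq_zero_or_pos m with hm | hm
  · subst hm; simp
  · have hE : 1 < Real.exp (Real.pi * m) := Real.one_lt_exp_iff.mpr (by positivity)
    apply div_le_div_of_nonneg_right _ (by linarith)
    have hsl := Real.sin_le (show 0 ≤ Real.pi * m / L by positivity)
    calc (n : ℝ) ^ 2 * L * Real.sin (Real.pi * m / L) ≤ (n : ℝ) ^ 2 * L * (Real.pi * m / L) :=
          mul_le_mul_of_nonneg_left hsl (by positivity)
      _ = Real.pi * (n : ℝ) ^ 2 * m := by field_simp

/-- reduced-angle data of the row `p`, `0 < p < L`: with `m = min(p, L − p)` and `w = πm/L`, both the row `p` (`u = πp/L`) and the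
row `L + p` (`u = π + πp/L`) have `|sin u| = sin w`, `|cos u| = cos w`, `0 < w ≤ π/2`. [folklore] -/
theorem row_reduced (p : ℕ) (hp0 : 0 < p) (hpL : p < L) :
    0 < Real.pi * ((min p (L - p) : ℕ) : ℝ) / L ∧ Real.pi * ((min p (L - p) : ℕ) : ℝ) / L ≤ Real.pi / 2 ∧
    |Real.sin (Real.pi * p / L)| = Real.sin (Real.pi * ((min p (L - p) : ℕ) : ℝ) / L) ∧
    |Real.cos (Real.pi * p / L)| = Real.cos (Real.pi * ((min p (L - p) : ℕ) : ℝ) / L) ∧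
    |Real.sin (Real.pi * ((L + p : ℕ) : ℝ) / L)| = Real.sin (Real.pi * ((min p (L - p) : ℕ) : ℝ) / L) ∧
    |Real.cos (Real.pi * ((L + p : ℕ) : ℝ) / L)| = Real.cos (Real.pi * ((min p (L - p) : ℕ) : ℝ) / L) := by
  have hL0 : (0 : ℝ) < L := by exact_mod_cast Nat.pos_of_ne_zero (NeZero.ne L)
  have hπ := Real.pi_pos
  set u : ℝ := Real.pi * p / L with hu
  have hu0 : 0 < u := by rw [hu]; positivity
  have huπ : u < Real.pi := by
    rw [hu, div_lt_iff₀ hL0]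
    have : (p : ℝ) < L := by exact_mod_cast hpL
    nlinarith
  have hsinu : 0 < Real.sin u := Real.sin_pos_of_pos_of_lt_pi hu0 huπ
  -- the second-block row: `π(L+p)/L = u + π`
  have e2 : Real.pi * ((L + p : ℕ) : ℝ) / L = u + Real.pi := by rw [hu]; push_cast; field_simp; ring
  have hs2 : |Real.sin (Real.pi * ((L + p : ℕ) : ℝ) / L)| = |Real.sin u| := by rw [e2, Real.sin_add_pi, abs_neg]
  have hc2 : |Real.cos (Real.pi * ((L + p : ℕ) : ℝ) / L)| = |Real.cos u| := by rw [e2, Real.cos_add_pi, abs_neg]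
  rw [hs2, hc2]
  rcases le_or_gt p (L - p) with h | h
  · -- `m = p`, `w = u ≤ π/2`
    have hm : min p (L - p) = p := min_eq_left h
    rw [hm]
    have hle : u ≤ Real.pi / 2 := by
      rw [hu, div_le_div_iff₀ hL0 (by norm_num)]
      have : 2 * (p : ℝ) ≤ L := by
        have : 2 * p ≤ L := by omega
        exact_mod_cast this
      nlinarith
    have hcosu : 0 ≤ Real.cos u := Real.cos_nonneg_of_mem_Icc ⟨by linarith, hle⟩
    exact ⟨hu0, hle, abs_of_pos hsinu, abs_of_nonneg hcosu, abs_of_pos hsinu, abs_of_nonneg hcosu⟩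
  · -- `m = L − p`, `w = π − u`
    have hm : min p (L - p) = L - p := min_eq_right h.le
    rw [hm]
    have ew : Real.pi * ((L - p : ℕ) : ℝ) / L = Real.pi - u := by
      rw [hu, Nat.cast_sub hpL.le]; field_simp
    rw [ew, Real.sin_pi_sub, Real.cos_pi_sub]
    have hw0 : 0 < Real.pi - u := by linarith
    have hle : Real.pi - u ≤ Real.pi / 2 := by
      rw [hu]
      have : (L : ℝ) ≤ 2 * p := by
        have : L ≤ 2 * p := by omega
        exact_mod_cast this
      rw [sub_le_iff_le_add, show Real.pi / 2 + Real.pi * p / L = (Real.pi * L / 2 + Real.pi * p) / L by field_simp,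
        le_div_iff₀ hL0]
      nlinarith
    have hcosu : Real.cos u ≤ 0 := by
      have : Real.pi / 2 ≤ u := by linarith
      exact Real.cos_nonpos_of_pi_div_two_le_of_le this (by linarith)
    refine ⟨hw0, hle, abs_of_pos hsinu, ?_, abs_of_pos hsinu, ?_⟩ <;> rw [abs_of_nonpos hcosu]

/-! ## The Lambert-type row sum `Σ_m m/(e^{πm} − 1) ≤ 3/50` -/

omit [NeZero L] in
/-- `e^π ≥ 20` (`e^π > e³ > 2.718³`). [folklore] -/
theorem twenty_le_exp_pi : (20 : ℝ) ≤ Real.exp Real.pi := by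
  have h1 := Real.exp_one_gt_d9
  have h3 : Real.exp 3 = Real.exp 1 ^ 3 := by
    rw [← Real.exp_nat_mul]; norm_num
  have hmono : Real.exp 3 ≤ Real.exp Real.pi := Real.exp_le_exp.mpr Real.pi_gt_three.le
  have h2 : (2.7182818283 : ℝ) ^ 3 ≤ Real.exp 1 ^ 3 := pow_le_pow_left₀ (by norm_num) h1.le 3
  have h20 : (20 : ℝ) ≤ (2.7182818283 : ℝ) ^ 3 := by norm_num
  linarith

omit [NeZero L] in
/-- ★ `Σ_{m<N} m/(e^{πm} − 1) ≤ 3/50` (`q = e^{−π} ≤ 1/20`; termwise `≤ m qᵐ/(1−q)`, `Σ m qᵐ ≤ q/(1−q)²`). [folklore] -/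
theorem lambert_row_sum_le (N : ℕ) : ∑ m ∈ Finset.range N, (m : ℝ) / (Real.exp (Real.pi * m) - 1) ≤ 3 / 50 := by
  set q : ℝ := Real.exp (-Real.pi) with hq
  have hq0 : 0 < q := Real.exp_pos _
  have hq1 : q ≤ 1 / 20 := by
    rw [hq, Real.exp_neg, inv_eq_one_div, div_le_div_iff₀ (Real.exp_pos _) (by norm_num)]
    linarith [twenty_le_exp_pi]
  have hq1' : q < 1 := by linarith
  -- termwise comparison with the geometric-derivative series
  have hterm : ∀ m : ℕ, (m : ℝ) / (Real.exp (Real.pi * m) - 1) ≤ 1 / (1 - q) * ((m : ℝ) * q ^ m) := by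
    intro m
    rcases Nat.eq_zero_or_pos m with hm | hm
    · subst hm; simp
    · have hE : Real.exp (Real.pi * m) * q ^ m = 1 := by
        rw [hq, ← Real.exp_nat_mul, ← Real.exp_add, show Real.pi * (m : ℝ) + (m : ℝ) * -Real.pi = 0 by ring,
          Real.exp_zero]
      have hEq : q * Real.exp (Real.pi * m) = Real.exp (Real.pi * (m - 1)) := by
        rw [hq, ← Real.exp_add]; ring_nf
      have hE1 : 1 ≤ q * Real.exp (Real.pi * m) := by
        rw [hEq]; apply Real.one_le_exp
        have : (1 : ℝ) ≤ m := by exact_mod_cast hm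
        nlinarith [Real.pi_pos]
      have hden : Real.exp (Real.pi * m) * (1 - q) ≤ Real.exp (Real.pi * m) - 1 := by nlinarith
      have hdenpos : 0 < Real.exp (Real.pi * m) * (1 - q) := by
        apply mul_pos (Real.exp_pos _); linarith
      have hqinv : (Real.exp (Real.pi * m))⁻¹ = q ^ m := inv_eq_of_mul_eq_one_right hE
      calc (m : ℝ) / (Real.exp (Real.pi * m) - 1) ≤ (m : ℝ) / (Real.exp (Real.pi * m) * (1 - q)) :=
            div_le_div_of_nonneg_left (by positivity) hdenpos hden
        _ = 1 / (1 - q) * ((m : ℝ) * q ^ m) := by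
            rw [← hqinv]
            field_simp
  have hsum : ∑ m ∈ Finset.range N, (m : ℝ) * q ^ m ≤ q / (1 - q) ^ 2 := by
    have hhs := hasSum_coe_mul_geometric_of_norm_lt_one (𝕜 := ℝ) (r := q)
      (by rw [Real.norm_eq_abs, abs_of_pos hq0]; exact hq1')
    exact sum_le_hasSum (Finset.range N) (fun m _ => by positivity) hhs
  calc ∑ m ∈ Finset.range N, (m : ℝ) / (Real.exp (Real.pi * m) - 1)
      ≤ ∑ m ∈ Finset.range N, 1 / (1 - q) * ((m : ℝ) * q ^ m) := Finset.sum_le_sum fun m _ => hterm m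
    _ = 1 / (1 - q) * ∑ m ∈ Finset.range N, (m : ℝ) * q ^ m := by rw [Finset.mul_sum]
    _ ≤ 1 / (1 - q) * (q / (1 - q) ^ 2) := mul_le_mul_of_nonneg_left hsum (by
        apply div_nonneg zero_le_one; linarith)
    _ = q / (1 - q) ^ 3 := by field_simp
    _ ≤ (1 / 20) / (19 / 20) ^ 3 := by
        have h19 : (19 / 20 : ℝ) ≤ 1 - q := by linarith
        have h19' : (19 / 20 : ℝ) ^ 3 ≤ (1 - q) ^ 3 := pow_le_pow_left₀ (by norm_num) h19 3
        calc q / (1 - q) ^ 3 ≤ q / (19 / 20) ^ 3 := div_le_div_of_nonneg_left hq0.le (by norm_num) h19'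
          _ ≤ (1 / 20) / (19 / 20) ^ 3 := div_le_div_of_nonneg_right hq1 (by norm_num)
    _ ≤ 3 / 50 := by norm_num

/-! ## The cotangent main term against its limit -/

/-- the cotangent main term against its limit: `|(1/(2L))Σ_{k<n} cot θ_k − (1/π)Σ_{k<n} 1/(2k+1)| ≤ πn²/(8L²)` (`2n ≤ L`). [folklore] -/
theorem cot_sum_approx (n : ℕ) (hn : 2 * n ≤ L) :
    |1 / (2 * (L : ℝ)) * ∑ k ∈ Finset.range n,
        Real.cos ((2 * k + 1) * Real.pi / (2 * L)) / Real.sin ((2 * k + 1) * Real.pi / (2 * L))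
      - 1 / Real.pi * ∑ k ∈ Finset.range n, 1 / (2 * (k : ℝ) + 1)| ≤ Real.pi * (n : ℝ) ^ 2 / (8 * (L : ℝ) ^ 2) := by
  have hL0 : (0 : ℝ) < L := by exact_mod_cast Nat.pos_of_ne_zero (NeZero.ne L)
  have hπ := Real.pi_pos
  rw [Finset.mul_sum, Finset.mul_sum, ← Finset.sum_sub_distrib]
  have hk : ∀ k ∈ Finset.range n,
      |1 / (2 * (L : ℝ)) * (Real.cos ((2 * k + 1) * Real.pi / (2 * L)) / Real.sin ((2 * k + 1) * Real.pi / (2 * L)))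
        - 1 / Real.pi * (1 / (2 * (k : ℝ) + 1))| ≤ (2 * (k : ℝ) + 1) * Real.pi / (8 * (L : ℝ) ^ 2) := by
    intro k hk
    have hkn := Finset.mem_range.mp hk
    set θ : ℝ := (2 * k + 1) * Real.pi / (2 * L) with hθ
    have hθ0 : 0 < θ := by rw [hθ]; positivity
    have hθ1 : θ < Real.pi / 2 := by
      rw [hθ, div_lt_div_iff₀ (by positivity) (by norm_num)]
      have : (2 * (k : ℝ) + 1) < L := by
        have : 2 * k + 1 < L := by omega
        exact_mod_cast this
      nlinarith
    have hb := abs_theta_cot_sub_one_le hθ0 hθ1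
    have hsinθ : Real.sin θ ≠ 0 := (Real.sin_pos_of_pos_of_lt_pi hθ0 (by linarith)).ne'
    have h2Lθ : 1 / Real.pi * (1 / (2 * (k : ℝ) + 1)) = 1 / (2 * L * θ) := by
      rw [hθ]; field_simp
    have e : 1 / (2 * (L : ℝ)) * (Real.cos θ / Real.sin θ) - 1 / Real.pi * (1 / (2 * (k : ℝ) + 1))
        = (1 / (2 * L * θ)) * (θ * Real.cos θ / Real.sin θ - 1) := by
      rw [h2Lθ]
      field_simp
    rw [e, abs_mul, abs_of_pos (by positivity : (0 : ℝ) < 1 / (2 * L * θ))]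
    calc 1 / (2 * L * θ) * |θ * Real.cos θ / Real.sin θ - 1| ≤ 1 / (2 * L * θ) * (θ ^ 2 / 2) :=
          mul_le_mul_of_nonneg_left hb (by positivity)
      _ = (2 * (k : ℝ) + 1) * Real.pi / (8 * (L : ℝ) ^ 2) := by rw [hθ]; field_simp; ring
  calc _ ≤ ∑ k ∈ Finset.range n, |1 / (2 * (L : ℝ)) * (Real.cos ((2 * k + 1) * Real.pi / (2 * L))
          / Real.sin ((2 * k + 1) * Real.pi / (2 * L))) - 1 / Real.pi * (1 / (2 * (k : ℝ) + 1))| :=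
        Finset.abs_sum_le_sum_abs _ _
    _ ≤ ∑ k ∈ Finset.range n, (2 * (k : ℝ) + 1) * Real.pi / (8 * (L : ℝ) ^ 2) := Finset.sum_le_sum hk
    _ = Real.pi * (n : ℝ) ^ 2 / (8 * (L : ℝ) ^ 2) := by
        have hodd : ∀ m : ℕ, ∑ k ∈ Finset.range m, (2 * (k : ℝ) + 1) = (m : ℝ) ^ 2 := by
          intro m
          induction m with
          | zero => simp
          | succ m ih => rw [Finset.sum_range_succ, ih]; push_cast; ring
        rw [← Finset.sum_div, ← Finset.sum_mul, hodd]; ring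

end Summit.HubbardSuperconductivity.HubbardSuperconductivity.Theorems.AnisotropyChord.Transfer.Fibre3

end
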